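import Literature.NumberTheory.Automorphic.CartanIwasawaDominanceGL
import HarnessLib

/-!
# Triangularity of the Satake transform of `GL_n`: `𝒮(T_{ϖ^a}) = c_a x^a + (terms x^μ, μ < a)` with `c_a ≠ 0`
# (Cartier 1979, proof of Thm. 4.1, step (c); Macdonald 1995, Ch. V (2.6)–(2.7), (3.3))

Topic `NumberTheory/Automorphic`; namespace `Literature.NumberTheory.Automorphic` (lane `lit-hodgefound`, Track 2 foundations;
seat `lit-hodgefound-p11`, generation 36, row g36-#12).  THEOREMS ONLY: no definition, no named fact, no instance, no notation.
Combines the tree's `satakeTransform_doubleCosetOperator` (`SatakeTransformGL`: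
`𝒮(T_g) = ∑_{α ∈ KgK/K} q^{-⟨ν, e(α)⟩} x^{e(α)}`) with `CartanIwasawaDominanceGL` (the exponents `e(α)` of the cosets
`α ⊆ K ϖ^a K` are dominated by `a`, with `|e(α)| = |a|`).  The `GL_n` counterpart of §3 of `HyperspecialUnitarySatakeInjective`.

## The print

[CartierCorvallis1979] §IV, proof of Thm. 4.1, step (c): «`Sc_λ = Σ_μ c(λ, μ) χ_μ` with `c(λ, λ) ≠ 0` and `c(λ, μ) = 0`
unless `μ ≤ λ`».  [Macdonald1995] Ch. V (2.6)–(2.7) and (3.3) for `GL_n(F)`: the transform of `c_λ = 𝟙_{K ϖ^λ K}` is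
`q^{…} P_λ = q^{-⟨ν,λ⟩}·(#…)·x^λ + lower terms` in the dominance order.

## What is formalised (`F` with a `ValuativeRel`, `𝒪[F]` a DVR with finite residue field, `ϖ` uniformizing, `a ∈ ℤⁿ` antitone)

* `coeff_satakeTransform_doubleCosetOperator_eq_card_mul` — the coefficient of `x^μ` in `𝒮(T_{ϖ^a})` is
  `#{α ∈ K ϖ^a K / K : e(α) = μ} · q^{-⟨ν, μ⟩}`.
* **`sum_le_of_coeff_satakeTransform_doubleCosetOperator_ne_zero`**, `sum_eq_of_coeff_satakeTransform_doubleCosetOperator_ne_zero`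
  — TRIANGULARITY: `x^μ` occurs in `𝒮(T_{ϖ^a})` only if `∑_{i<r} μ_i ≤ ∑_{i<r} a_i` for all `r` and `|μ| = |a|`.
* **`coeff_self_satakeTransform_doubleCosetOperator_ne_zero`** — the leading coefficient `c(a, a)` is non-zero (the coset
  `ϖ^a K` contributes; all contributions are positive multiples of `q^{-⟨ν, a⟩}`).

## References
* [CartierCorvallis1979] P. Cartier, *Representations of 𝔭-adic groups: a survey*, PSPM 33.1 (1979), §IV, Thm. 4.1, proof,
  step (c).
* [Macdonald1995] I. G. Macdonald, *Symmetric Functions and Hall Polynomials*, 2nd ed. (1995), Ch. V (2.6)–(2.7), (3.3).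
-/

noncomputable section

open scoped MatrixGroups
open ValuativeRel Matrix Finset MonoidAlgebra

namespace Literature.NumberTheory.Automorphic

variable {F : Type*} [Field F] [ValuativeRel F] {n : ℕ} [IsDiscreteValuationRing 𝒪[F]] [Finite 𝓀[F]] {ϖ : F}
  [IsHeckeTriple (⊤ : Submonoid (GL (Fin n) F)) (glInt n F) (glInt n F)]

/-- **Coefficient formula**: the coefficient of `x^μ` in `𝒮(T_g)` is `#{α ∈ KgK/K : e(α) = μ} · q^{-⟨ν, μ⟩}` (over any
`ValuativeRel` field with a DVR valuation ring and finite residue field; the tree's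
`coeff_satakeTransform_doubleCosetOperator` of `SatakeParametersGLXiDegree` is the same formula stated under
`IsNonarchimedeanLocalField`). [cite: Macdonald1995, Ch. V (3.3)] [cite: CartierCorvallis1979, §IV (4.2)] -/
theorem coeff_satakeTransform_doubleCosetOperator_eq_card_mul (hϖ : IsUniformizingElement ϖ) (g : GL (Fin n) F)
    (μ : Fin n → ℤ) :
    (satakeTransform hϖ (heckeAlgebra.doubleCosetOperator (glInt n F) g)).coeff μ =
      (((finite_orbit_quotient (glInt n F) g).toFinset.filter fun α => iwasawaExp hϖ α.out = μ).card : ℂ) *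
        satakeWeight (Nat.card 𝓀[F] : ℂ) μ := by
  classical
  rw [satakeTransform_doubleCosetOperator, AddMonoidAlgebra.coeff_sum, Finsupp.finsetSum_apply]
  rw [Finset.sum_congr rfl fun α _ => by rw [AddMonoidAlgebra.coeff_single, Finsupp.single_apply]]
  have h1 : ∀ α : GL (Fin n) F ⧸ glInt n F,
      (if iwasawaExp hϖ α.out = μ then satakeWeight (Nat.card 𝓀[F] : ℂ) (iwasawaExp hϖ α.out) else 0) =
        if iwasawaExp hϖ α.out = μ then satakeWeight (Nat.card 𝓀[F] : ℂ) μ else 0 := fun α => by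
    split_ifs with h
    · rw [h]
    · rfl
  simp_rw [h1]
  rw [← Finset.sum_filter, Finset.sum_const, nsmul_eq_mul]

/-- **TRIANGULARITY OF `𝒮(T_{ϖ^a})` (dominance)**: if `x^μ` occurs in `𝒮(T_{ϖ^a})` (`a` antitone), then
`∑_{i<r} μ_i ≤ ∑_{i<r} a_i` for every `r` — Cartier's «`c(λ, μ) = 0` unless `μ ≤ λ`», via Macdonald (2.6)
(`sum_iwasawaExp_head_le_of_mem_orbit`). [cite: CartierCorvallis1979, §IV, proof of Thm. 4.1] [cite: Macdonald1995, Ch. V (2.6)] -/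
theorem sum_le_of_coeff_satakeTransform_doubleCosetOperator_ne_zero (hϖ : IsUniformizingElement ϖ) {a : Fin n → ℤ}
    (ha : Antitone a) {μ : Fin n → ℤ}
    (hμ : (satakeTransform hϖ (heckeAlgebra.doubleCosetOperator (glInt n F) (zpowDiagGL hϖ.ne_zero a))).coeff μ ≠ 0)
    (r : ℕ) : (∑ i : Fin n, if (i : ℕ) < r then μ i else 0) ≤ ∑ i : Fin n, if (i : ℕ) < r then a i else 0 := by
  classical
  rw [coeff_satakeTransform_doubleCosetOperator_eq_card_mul] at hμ
  have hne : ((finite_orbit_quotient (glInt n F) (zpowDiagGL hϖ.ne_zero a)).toFinset.filter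
      fun α => iwasawaExp hϖ α.out = μ).Nonempty := by
    rw [← Finset.card_pos, Nat.pos_iff_ne_zero]
    intro h0
    rw [h0, Nat.cast_zero, zero_mul] at hμ
    exact hμ rfl
  obtain ⟨α, hα⟩ := hne
  obtain ⟨hαorb, hαμ⟩ := Finset.mem_filter.1 hα
  rw [← hαμ]
  have hαorb' : (α.out : GL (Fin n) F ⧸ glInt n F) ∈ MulAction.orbit (glInt n F) (zpowDiagGL hϖ.ne_zero a : GL (Fin n) F ⧸ glInt n F) := by
    rw [QuotientGroup.out_eq']
    exact (Set.Finite.mem_toFinset _).1 hαorb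
  exact sum_iwasawaExp_head_le_of_mem_orbit hϖ ha hαorb' r

/-- The exponents occurring in `𝒮(T_{ϖ^a})` have total degree `|a|`. [cite: Macdonald1995, Ch. V (2.6)] -/
theorem sum_eq_of_coeff_satakeTransform_doubleCosetOperator_ne_zero (hϖ : IsUniformizingElement ϖ) {a : Fin n → ℤ}
    {μ : Fin n → ℤ}
    (hμ : (satakeTransform hϖ (heckeAlgebra.doubleCosetOperator (glInt n F) (zpowDiagGL hϖ.ne_zero a))).coeff μ ≠ 0) :
    ∑ i, μ i = ∑ i, a i := by
  classical
  rw [coeff_satakeTransform_doubleCosetOperator_eq_card_mul] at hμ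
  have hne : ((finite_orbit_quotient (glInt n F) (zpowDiagGL hϖ.ne_zero a)).toFinset.filter
      fun α => iwasawaExp hϖ α.out = μ).Nonempty := by
    rw [← Finset.card_pos, Nat.pos_iff_ne_zero]
    intro h0
    rw [h0, Nat.cast_zero, zero_mul] at hμ
    exact hμ rfl
  obtain ⟨α, hα⟩ := hne
  obtain ⟨hαorb, hαμ⟩ := Finset.mem_filter.1 hα
  rw [← hαμ]
  have hαorb' : (α.out : GL (Fin n) F ⧸ glInt n F) ∈ MulAction.orbit (glInt n F) (zpowDiagGL hϖ.ne_zero a : GL (Fin n) F ⧸ glInt n F) := by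
    rw [QuotientGroup.out_eq']
    exact (Set.Finite.mem_toFinset _).1 hαorb
  exact sum_iwasawaExp_eq_of_mem_orbit hϖ hαorb'

/-- **The leading coefficient `c(a, a) ≠ 0`**: `x^a` occurs in `𝒮(T_{ϖ^a})` (the coset `ϖ^a K` has exponent `a`, and the
residue field is finite so `q ≠ 0`). [cite: CartierCorvallis1979, §IV, proof of Thm. 4.1] [cite: Macdonald1995, Ch. V (2.7)] -/
theorem coeff_self_satakeTransform_doubleCosetOperator_ne_zero (hϖ : IsUniformizingElement ϖ)
    (a : Fin n → ℤ) :
    (satakeTransform hϖ (heckeAlgebra.doubleCosetOperator (glInt n F) (zpowDiagGL hϖ.ne_zero a))).coeff a ≠ 0 := by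
  classical
  rw [coeff_satakeTransform_doubleCosetOperator_eq_card_mul]
  refine mul_ne_zero (Nat.cast_ne_zero.2 (Finset.card_ne_zero.2 ⟨(zpowDiagGL hϖ.ne_zero a : GL (Fin n) F ⧸ glInt n F),
    Finset.mem_filter.2 ⟨(Set.Finite.mem_toFinset _).2 (MulAction.mem_orbit_self _), ?_⟩⟩))
    (satakeWeight_ne_zero natCard_residueField_ne_zero a)
  rw [iwasawaExp_out_coe]
  exact iwasawaExp_eq hϖ (Subgroup.one_mem _) (Subgroup.one_mem _) (by rw [one_mul, mul_one])

end Literature.NumberTheory.Automorphic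

end
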